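import Summits.MatrixMultiplication.MatrixMultiplication.Theorems.SoloInformedCwTwoBoundaryRanks
import Summits.MatrixMultiplication.MatrixMultiplication.Theorems.SoloInformedCwTwoNormalForms
import Literature.Computability.AlgebraicComplexity.CoppersmithWinograd1982Crude
import HarnessLib

/-!
# The border-rank dichotomy of the `21` nilpotent classes below `T_{cw,2}` (solo-informed, gen 25)

Seventh file of the §2n series.  Every nilpotent tensor of `ℂ³ ⊗ ℂ³ ⊗ ℂ³` has border rank `≤ 4`; of the `21`
Nurmiev classes below `T_{cw,2}` (`SoloInformedCwTwoNormalForms`), exactly five have border rank `4`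
and sixteen have border rank `≤ 3`.  This file proves the dichotomy ON THE LITERAL NORMAL FORMS:

* `algBorderRank_nurmiev_eq_four_of_mem`: `R̲(N_k) = 4` for `k ∈ {3, 5, 6, 7, 11}` — lower bounds by `p = 1`
  Koszul–Young integer certificates (ranks `7 > 6`; for `N₁₁` on the tensor with its first two factors
  swapped, transported by the invariance `algBorderRank_swap₁₂` proved here after Bläser 2013, Thm. 6.3(1),
  the tree having only `swap₂₃`), upper bounds by Glynn's formula `4·P = Σ_{δ∈{1}×{±1}²} (δ₁δ₂)·δ^{⊗3}`
  composed with the certificates `P ⊵ N_k` (`N₆`: `SoloInformedCwTwoBoundaryRanks`);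
* `algBorderRank_nurmiev_le_three_of_mem`: `R̲(N_k) ≤ 3` for `k ∈ {8, 9, 10, 12, 13, 14, 15, 16, 17, 18, 19, 20, 21, 22, 23, 24}` — the
  fourteen toric certificates of `SoloInformedCwTwoNormalForms` plus `N₁₀ ≅ T_{ℂ[t]/t³}` (the classical
  three-point approximation of `ℂ[t]/t³` by `ℂ[t]/(t(t-ε)(t+ε)) ≅ ℂ³`, transported along the isomorphism)
  and `N₁₃ = ` the restriction of `T_{ℂ[t]/t³}` to the slices `{1, t}`.

* `door_shadow_catalogue`: with door D1 (`R̃(T_{cw,2}) ≤ 3`), `R̃(N_k) ≤ 3` on all `21` classes and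
  `R̃ = 3 < 4 = R̲` exactly on the five border-rank-`4` classes (`3 ≤ R̃` by dual pairs on the normal
  forms); on the sixteen others `R̃ ≤ R̲ ≤ 3` unconditionally (`asymptoticRank_nurmiev_le_three_of_mem`).
-/

noncomputable section

open scoped BigOperators Polynomial

namespace Summit.MatrixMultiplication.MatrixMultiplication.Theorems

open Polynomial Literature.Computability.AlgebraicComplexity Literature.LinearAlgebra.Matrix
open Literature.Barriers.MatrixMultiplication (PolyDegeneratesTo
  asymptoticRank_le_of_polyDegeneratesTo)

/-! ## Border rank is invariant under swapping the first two factors (Bläser 2013, Thm. 6.3(1)) -/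

section Swap

variable {K : Type*} [Field K] {ι κ μ : Type*}

/-- An approximate decomposition of `t` gives one of `t` with its first two factors swapped. -/
theorem isApproxDecomposition_swap₁₂ {h : ℕ} {t : ι → κ → μ → K} {r : ℕ} {u : Fin r → ι → K[X]}
    {v : Fin r → κ → K[X]} {w : Fin r → μ → K[X]} (hd : IsApproxDecomposition h t u v w) :
    IsApproxDecomposition h (fun b a c => t a b c) v u w := by
  intro b a c j hj
  rw [show (∑ ρ, v ρ b * u ρ a * w ρ c) = ∑ ρ, u ρ a * v ρ b * w ρ c from
    Finset.sum_congr rfl fun ρ _ => by rw [mul_comm (v ρ b) (u ρ a)]]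
  exact hd a b c j hj

/-- `R_h` does not increase under swapping the first two factors. -/
theorem approxRank_swap₁₂_le [Fintype ι] [Fintype κ] [Fintype μ] [DecidableEq ι] [DecidableEq κ]
    [DecidableEq μ] (h : ℕ) (t : ι → κ → μ → K) :
    approxRank h (fun b a c => t a b c) ≤ approxRank h t := by
  obtain ⟨u, v, w, hd⟩ := exists_isApproxDecomposition_approxRank h t
  exact approxRank_le_of_isApproxDecomposition (isApproxDecomposition_swap₁₂ hd)

/-- **`R̲` is invariant under swapping the first two factors.** -/
theorem algBorderRank_swap₁₂ [Fintype ι] [Fintype κ] [Fintype μ] [DecidableEq ι] [DecidableEq κ]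
    [DecidableEq μ] (t : ι → κ → μ → K) :
    algBorderRank (fun b a c => t a b c) = algBorderRank t := by
  refine le_antisymm ?_ ?_
  · obtain ⟨h₀, hh⟩ := exists_algBorderRank_eq_approxRank t
    rw [hh]
    exact (algBorderRank_le_approxRank h₀ _).trans (approxRank_swap₁₂_le h₀ t)
  · obtain ⟨h₀, hh⟩ := exists_algBorderRank_eq_approxRank (fun b a c => t a b c)
    rw [hh]
    exact (algBorderRank_le_approxRank h₀ _).trans (approxRank_swap₁₂_le h₀ fun b a c => t a b c)

end Swap

/-! ## Border rank `4`: Koszul–Young lower bounds and Glynn upper bounds on the normal forms -/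

/-- `p = 1` Koszul–Young flattening of the normal form `N_3`: `7` certified independent rows. -/
theorem nurmiev_3_kyCheck :
    intTriCheck 7 (KYCert.kyEntry 3 3 3 [[1, 0, 0], [0, 1, 0], [0, 0, 1]] (nurmievInt 3))
      [[(3, 1)], [(2, 1), (6, 1)], [(6, 1)], [(1, -1), (3, 1)], [(0, 1)], [(5, 1)], [(4, 1)]] [0, 1,
        3, 4, 5, 6, 7] = true := by
  decide +kernel

/-- `4 ≤ R̲(N_3)` over `ℂ`. -/
theorem four_le_algBorderRank_nurmiev_3 : 4 ≤ algBorderRank (nurmiev ℂ 3) :=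
  KYCert.le_algBorderRank_of_kyCheck ℂ _ (nurmievInt 3) nurmiev_3_kyCheck (by norm_num)

/-- `p = 1` Koszul–Young flattening of the normal form `N_5`: `7` certified independent rows. -/
theorem nurmiev_5_kyCheck :
    intTriCheck 7 (KYCert.kyEntry 3 3 3 [[1, 0, 0], [0, 1, 0], [0, 0, 1]] (nurmievInt 5))
      [[(3, -1), (4, 1)], [(0, 1), (1, -1)], [(2, 1)], [(1, 1)], [(5, 1)], [(6, 1)], [(3, 1)]] [0,
        1, 3, 5, 6, 7, 8] = true := by
  decide +kernel

/-- `4 ≤ R̲(N_5)` over `ℂ`. -/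
theorem four_le_algBorderRank_nurmiev_5 : 4 ≤ algBorderRank (nurmiev ℂ 5) :=
  KYCert.le_algBorderRank_of_kyCheck ℂ _ (nurmievInt 5) nurmiev_5_kyCheck (by norm_num)

/-- `p = 1` Koszul–Young flattening of the normal form `N_7`: `7` certified independent rows. -/
theorem nurmiev_7_kyCheck :
    intTriCheck 7 (KYCert.kyEntry 3 3 3 [[1, 0, 0], [0, 1, 0], [0, 0, 1]] (nurmievInt 7))
      [[(1, 1), (6, 1)], [(3, 1)], [(2, 1)], [(6, 1)], [(0, 1)], [(5, 1)], [(4, 1)]] [0, 1, 3, 4, 5,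
        6, 7] = true := by
  decide +kernel

/-- `4 ≤ R̲(N_7)` over `ℂ`. -/
theorem four_le_algBorderRank_nurmiev_7 : 4 ≤ algBorderRank (nurmiev ℂ 7) :=
  KYCert.le_algBorderRank_of_kyCheck ℂ _ (nurmievInt 7) nurmiev_7_kyCheck (by norm_num)

/-- `p = 1` Koszul–Young flattening of `N₁₁` with its first two factors swapped (on `N₁₁` itself the
first-factor flattening only has rank `6`): `7` certified independent rows. -/
theorem nurmiev_11_swap_kyCheck :
    intTriCheck 7 (KYCert.kyEntry 3 3 3 [[1, 0, 0], [0, 1, 0], [0, 0, 1]]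
      (fun a b c => nurmievInt 11 b a c))
      [[(3, 1)], [(0, 1)], [(2, 1)], [(1, 1)], [(5, 1)], [(4, 1)], [(2, 1), (6, 1)]] [0, 2, 3, 4, 6,
        7, 8] = true := by
  decide +kernel

/-- `4 ≤ R̲(N₁₁)` over `ℂ` (via `algBorderRank_swap₁₂`). -/
theorem four_le_algBorderRank_nurmiev_11 : 4 ≤ algBorderRank (nurmiev ℂ 11) := by
  have h := KYCert.le_algBorderRank_of_kyCheck ℂ _ (fun a b c => nurmievInt 11 b a c)
    nurmiev_11_swap_kyCheck (show 2 * (4 - 1) < 7 by norm_num)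
  have h' : 4 ≤ algBorderRank (fun b a c => nurmiev ℂ 11 a b c) := h
  rwa [algBorderRank_swap₁₂ (nurmiev ℂ 11)] at h'

/-- `R̲(N₃) ≤ 4`: the certificate `P ⊵ N₃` composed with Glynn's formula — order `1`,
multiplier `192`. -/
theorem nurmiev_3_border_check :
    ApproxCert.check 3 3 3 4 1 192 (nurmievInt 3)
      ![![[1], [-3], []], ![[-5, -2], [-1, -2], [0, -2]], ![[3], [3], []],
        ![[1, 2], [1, 2], [0, 2]]]
      ![![[-12, 6], [12, -6], [0, -6]], ![[4, 6], [-4, -6], [0, -6]], ![[4], [12], []], ![[20],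
        [-4], []]]
      ![![[-2, -2], [0, 2], [0, -7]], ![[6, -6], [0, 6], [0, 9]], ![[-2, -2], [0, 2], [0, -1]],
        ![[6, -6], [0, 6], [0, 15]]] = true := by
  decide +kernel

/-- **`R̲(N₃) = 4`** over `ℂ`. -/
theorem algBorderRank_nurmiev_3 : algBorderRank (nurmiev ℂ 3) = 4 :=
  le_antisymm (ApproxCert.algBorderRank_le_of_check ℂ nurmiev_3_border_check
    (isUnit_iff_ne_zero.mpr (by norm_num))) four_le_algBorderRank_nurmiev_3

/-- `R̲(N₅) ≤ 4`: the certificate `P ⊵ N₅` composed with Glynn's formula — order `3`,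
multiplier `96`. -/
theorem nurmiev_5_border_check :
    ApproxCert.check 3 3 3 4 3 96 (nurmievInt 5)
      ![![[2, 0, 0, 1], [0, 0, -6], [0, 0, 0, 1]], ![[6, 0, 0, 7], [0, 0, -2], [0, 0, 0, 7]], ![[-2,
        0, 0, 1], [0, 0, 2], [0, 0, 0, 1]], ![[-6, 0, 0, -9], [0, 0, 6], [0, 0, 0, -9]]]
      ![![[0, 0, 0, -6], [0, 9], [0, 0, 0, -6]], ![[0, 0, 0, -6], [0, -3], [0, 0, 0, -6]], ![[8],
        [0, 9], []], ![[8], [0, -3], []]]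
      ![![[-2], [1], []], ![[-2, 0, 0, 2], [-3, 0, 0, 4], [0, 0, 0, -2]], ![[], [3], []], ![[0, 0,
        0, 2], [-1, 0, 0, 4], [0, 0, 0, -2]]] = true := by
  decide +kernel

/-- **`R̲(N₅) = 4`** over `ℂ`. -/
theorem algBorderRank_nurmiev_5 : algBorderRank (nurmiev ℂ 5) = 4 :=
  le_antisymm (ApproxCert.algBorderRank_le_of_check ℂ nurmiev_5_border_check
    (isUnit_iff_ne_zero.mpr (by norm_num))) four_le_algBorderRank_nurmiev_5

/-- `R̲(N₇) ≤ 4`: the certificate `P ⊵ N₇` composed with Glynn's formula — order `3`,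
multiplier `16`. -/
theorem nurmiev_7_border_check :
    ApproxCert.check 3 3 3 4 3 16 (nurmievInt 7)
      ![![[], [0, 0, 1], [0, 4]], ![[-4], [0, 0, 3], [0, -4]], ![[-4], [0, 0, -1], [0, -4]], ![[8],
        [0, 0, -3], [0, 4]]]
      ![![[], [0, 0, 2], [0, 0, 0, -1]], ![[-2], [], [0, 0, 0, 3]], ![[2], [0, 0, 2], [0, 0, 0,
        -5]], ![[], [], [0, 0, 0, -1]]]
      ![![[2], [0, -4], [0, 0, 0, 1]], ![[], [0, -2], [0, 0, 0, 1]], ![[], [0, -2], [0, 0, 0, -1]],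
        ![[-2], [], [0, 0, 0, -1]]] = true := by
  decide +kernel

/-- **`R̲(N₇) = 4`** over `ℂ`. -/
theorem algBorderRank_nurmiev_7 : algBorderRank (nurmiev ℂ 7) = 4 :=
  le_antisymm (ApproxCert.algBorderRank_le_of_check ℂ nurmiev_7_border_check
    (isUnit_iff_ne_zero.mpr (by norm_num))) four_le_algBorderRank_nurmiev_7

/-- `R̲(N₁₁) ≤ 4`: the certificate `P ⊵ N₁₁` composed with Glynn's formula — order `4`,
multiplier `48`. -/
theorem nurmiev_11_border_check :
    ApproxCert.check 3 3 3 4 4 48 (nurmievInt 11)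
      ![![[0, -12], [6], []], ![[0, 4], [], [0, 0, -8]], ![[0, 4], [-6], [0, 0, 8]], ![[0, 4], [],
        []]]
      ![![[-2], [0, 0, 3], []], ![[], [0, 0, 3], [0, 0, 0, -2]], ![[-2], [0, 0, -3], [0, 0, 0, -2]],
        ![[], [0, 0, -3], [0, 0, 0, -4]]]
      ![![[], [0, 0, 0, 0, -2], [0, 0, 0, 3]], ![[-2], [], [0, 0, 0, 3]], ![[], [0, 0, 0, 0, 2], [0,
        0, 0, 3]], ![[-2], [0, 0, 0, 0, 4], [0, 0, 0, 3]]] = true := by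
  decide +kernel

/-- **`R̲(N₁₁) = 4`** over `ℂ`. -/
theorem algBorderRank_nurmiev_11 : algBorderRank (nurmiev ℂ 11) = 4 :=
  le_antisymm (ApproxCert.algBorderRank_le_of_check ℂ nurmiev_11_border_check
    (isUnit_iff_ne_zero.mpr (by norm_num))) four_le_algBorderRank_nurmiev_11

/-- **`R̲(N_k) = 4` for the five classes `k ∈ {3, 5, 6, 7, 11}`.** -/
theorem algBorderRank_nurmiev_eq_four_of_mem (k : ℕ) (hk : k ∈ ({3, 5, 6, 7, 11} : Finset ℕ)) :
    algBorderRank (nurmiev ℂ k) = 4 := by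
  simp only [Finset.mem_insert, Finset.mem_singleton] at hk
  rcases hk with rfl | rfl | rfl | rfl | rfl
  · exact algBorderRank_nurmiev_3
  · exact algBorderRank_nurmiev_5
  · exact algBorderRank_nurmiev_six
  · exact algBorderRank_nurmiev_7
  · exact algBorderRank_nurmiev_11

/-! ## Border rank `≤ 3`: the two remaining classes `N₁₀`, `N₁₃` -/

/-- `R̲(T_{ℂ[t]/t³}) ≤ 3`: the classical three-point approximation (Lagrange idempotents of
`ℂ[t]/(t(t-ε)(t+ε)) ≅ ℂ³`), order `2`, multiplier `2`. -/
theorem truncPoly_unit_check :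
    ApproxCert.check 3 3 3 3 2 2 truncPolyInt
      ![![[1], [], []], ![[1], [0, 1], [0, 0, 1]], ![[1], [0, -1], [0, 0, 1]]]
      ![![[1], [], []], ![[1], [0, 1], [0, 0, 1]], ![[1], [0, -1], [0, 0, 1]]]
      ![![[0, 0, 2], [], [-2]], ![[], [0, 1], [1]], ![[], [0, -1], [1]]] = true := by
  decide +kernel

/-- `R̲(T_{ℂ[t]/t³}) ≤ 3` over `ℂ`. -/
theorem algBorderRank_truncPoly_le_three : algBorderRank (truncPoly ℂ) ≤ 3 :=
  ApproxCert.algBorderRank_le_of_check ℂ truncPoly_unit_check (isUnit_iff_ne_zero.mpr (by norm_num))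

/-- `R̲(N₁₀) ≤ 3`: the three-point approximation transported along `T_{ℂ[t]/t³} ≅ N₁₀`. -/
theorem nurmiev_10_unit_check :
    ApproxCert.check 3 3 3 3 2 2 (nurmievInt 10)
      ![![[-1], [], []], ![[-1, -1, -1], [0, -1, -1], [0, 0, -1]], ![[-1, 1, -1], [0, 1, -1], [0, 0,
        -1]]]
      ![![[1], [], []], ![[1, 1, 1], [0, 1, 1], [0, 0, 1]], ![[1, -1, 1], [0, -1, 1], [0, 0, 1]]]
      ![![[2, 0, -2], [0, 0, 4], [0, 0, -2]], ![[-1, 2], [0, -1], []],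
        ![[-1, -2], [0, 1], []]] = true := by
  decide +kernel

/-- `R̲(N₁₃) ≤ 3`: `N₁₃` is the restriction of `T_{ℂ[t]/t³}` to the slices `1, t` (third factor
reversed), so the three-point approximation restricts. -/
theorem nurmiev_13_unit_check :
    ApproxCert.check 3 3 3 3 2 2 (nurmievInt 13)
      ![![[1], [], []], ![[1], [0, 1], []], ![[1], [0, -1], []]]
      ![![[1], [], []], ![[1], [0, 1], [0, 0, 1]], ![[1], [0, -1], [0, 0, 1]]]
      ![![[-2], [], [0, 0, 2]], ![[1], [0, 1], []], ![[1], [0, -1], []]] = true := by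
  decide +kernel

/-- **`R̲(N_k) ≤ 3` for the sixteen classes
`k ∈ {8, 9, 10, 12, 13, 14, 15, 16, 17, 18, 19, 20, 21, 22, 23, 24}`.** -/
theorem algBorderRank_nurmiev_le_three_of_mem (k : ℕ)
    (hk : k ∈ ({8, 9, 10, 12, 13, 14, 15, 16, 17, 18, 19, 20, 21, 22, 23, 24} : Finset ℕ)) :
    algBorderRank (nurmiev ℂ k) ≤ 3 := by
  simp only [Finset.mem_insert, Finset.mem_singleton] at hk
  rcases hk with rfl | rfl | rfl | rfl | rfl | rfl | rfl | rfl | rfl | rfl | rfl | rfl | rfl | rfl |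
    rfl | rfl
  · exact algBorderRank_nurmiev_le_three 8 (by simp)
  · exact algBorderRank_nurmiev_le_three 9 (by simp)
  · exact ApproxCert.algBorderRank_le_of_check ℂ nurmiev_10_unit_check
      (isUnit_iff_ne_zero.mpr (by norm_num))
  · exact algBorderRank_nurmiev_le_three 12 (by simp)
  · exact ApproxCert.algBorderRank_le_of_check ℂ nurmiev_13_unit_check
      (isUnit_iff_ne_zero.mpr (by norm_num))
  · exact algBorderRank_nurmiev_le_three 14 (by simp)
  · exact algBorderRank_nurmiev_le_three 15 (by simp)
  · exact algBorderRank_nurmiev_le_three 16 (by simp)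
  · exact algBorderRank_nurmiev_le_three 17 (by simp)
  · exact algBorderRank_nurmiev_le_three 18 (by simp)
  · exact algBorderRank_nurmiev_le_three 19 (by simp)
  · exact algBorderRank_nurmiev_le_three 20 (by simp)
  · exact algBorderRank_nurmiev_le_three 21 (by simp)
  · exact algBorderRank_nurmiev_le_three 22 (by simp)
  · exact algBorderRank_nurmiev_le_three 23 (by simp)
  · exact algBorderRank_nurmiev_le_three 24 (by simp)

/-- **The dichotomy**, packaged: below the door, border rank `4` on `N₃, N₅, N₆, N₇, N₁₁` and
`≤ 3` on the other sixteen classes. -/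
theorem boundary_borderRank_dichotomy :
    (∀ k ∈ ({3, 5, 6, 7, 11} : Finset ℕ), algBorderRank (nurmiev ℂ k) = 4) ∧
      ∀ k ∈ ({8, 9, 10, 12, 13, 14, 15, 16, 17, 18, 19, 20, 21, 22, 23, 24} : Finset ℕ),
        algBorderRank (nurmiev ℂ k) ≤ 3 :=
  ⟨algBorderRank_nurmiev_eq_four_of_mem, algBorderRank_nurmiev_le_three_of_mem⟩


/-! ## The door's shadow, complete -/

/-- Unconditionally `R̃(N_k) ≤ R̃(T_{cw,2})` for all `21` classes below the door. -/
theorem asymptoticRank_nurmiev_le_cwTensor_two (k : ℕ)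
    (hk : k ∈ ({3, 5, 6, 7, 8, 9, 10, 11, 12, 13, 14, 15, 16, 17, 18, 19, 20, 21, 22, 23, 24} :
      Finset ℕ)) :
    asymptoticRank (nurmiev ℂ k) ≤ asymptoticRank (cwTensor ℂ 2) :=
  asymptoticRank_le_of_polyDegeneratesTo (cwTensor_two_polyDegeneratesTo_nurmiev_of_mem k hk)

/-- Unconditionally `R̃(N_k) ≤ 3` on the sixteen classes of border rank `≤ 3` — there door D1 says
nothing new. -/
theorem asymptoticRank_nurmiev_le_three_of_mem (k : ℕ)
    (hk : k ∈ ({8, 9, 10, 12, 13, 14, 15, 16, 17, 18, 19, 20, 21, 22, 23, 24} : Finset ℕ)) :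
    asymptoticRank (nurmiev ℂ k) ≤ 3 := by
  exact_mod_cast asymptoticRank_le_of_algBorderRank_le (algBorderRank_nurmiev_le_three_of_mem k hk)

/-- `3 ≤ R̃(N₃)`: the `x`-slices of the normal form are linearly independent (scaled dual
pairs at the cells `![0, 0, 0]` / `![2, 1, 0]`). -/
theorem three_le_asymptoticRank_nurmiev_3 : (3 : ℝ) ≤ asymptoticRank (nurmiev ℂ 3) := by
  have h3 : (3 : ℝ) = (Fintype.card (Fin 3) : ℝ) := by norm_num
  rw [h3]
  refine card_le_asymptoticRank_of_scaledDualPairs (nurmiev ℂ 3) ![0, 0, 0] ![2, 1, 0] ![1, 1, 1]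
    ?_ ?_
  · intro o; fin_cases o <;> norm_num
  · intro o o'
    fin_cases o <;> fin_cases o' <;> simp [nurmiev, nurmievInt, ApproxCert.ofEntries]

/-- `3 ≤ R̃(N₅)`: the `x`-slices of the normal form are linearly independent (scaled dual
pairs at the cells `![0, 1, 0]` / `![2, 0, 1]`). -/
theorem three_le_asymptoticRank_nurmiev_5 : (3 : ℝ) ≤ asymptoticRank (nurmiev ℂ 5) := by
  have h3 : (3 : ℝ) = (Fintype.card (Fin 3) : ℝ) := by norm_num
  rw [h3]
  refine card_le_asymptoticRank_of_scaledDualPairs (nurmiev ℂ 5) ![0, 1, 0] ![2, 0, 1] ![1, 1, 1]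
    ?_ ?_
  · intro o; fin_cases o <;> norm_num
  · intro o o'
    fin_cases o <;> fin_cases o' <;> simp [nurmiev, nurmievInt, ApproxCert.ofEntries]

/-- `3 ≤ R̃(N₇)`: the `x`-slices of the normal form are linearly independent (scaled dual
pairs at the cells `![0, 0, 1]` / `![2, 1, 0]`). -/
theorem three_le_asymptoticRank_nurmiev_7 : (3 : ℝ) ≤ asymptoticRank (nurmiev ℂ 7) := by
  have h3 : (3 : ℝ) = (Fintype.card (Fin 3) : ℝ) := by norm_num
  rw [h3]
  refine card_le_asymptoticRank_of_scaledDualPairs (nurmiev ℂ 7) ![0, 0, 1] ![2, 1, 0] ![1, 1, 1]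
    ?_ ?_
  · intro o; fin_cases o <;> norm_num
  · intro o o'
    fin_cases o <;> fin_cases o' <;> simp [nurmiev, nurmievInt, ApproxCert.ofEntries]

/-- `3 ≤ R̃(N₁₁)`: the `x`-slices of the normal form are linearly independent (scaled dual
pairs at the cells `![0, 0, 1]` / `![2, 1, 0]`). -/
theorem three_le_asymptoticRank_nurmiev_11 : (3 : ℝ) ≤ asymptoticRank (nurmiev ℂ 11) := by
  have h3 : (3 : ℝ) = (Fintype.card (Fin 3) : ℝ) := by norm_num
  rw [h3]
  refine card_le_asymptoticRank_of_scaledDualPairs (nurmiev ℂ 11) ![0, 0, 1] ![2, 1, 0] ![1, 1, 1]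
    ?_ ?_
  · intro o; fin_cases o <;> norm_num
  · intro o o'
    fin_cases o <;> fin_cases o' <;> simp [nurmiev, nurmievInt, ApproxCert.ofEntries]

/-- `3 ≤ R̃(N_k)` on the five border-rank-`4` classes (all concise). -/
theorem three_le_asymptoticRank_nurmiev_of_mem (k : ℕ) (hk : k ∈ ({3, 5, 6, 7, 11} : Finset ℕ)) :
    (3 : ℝ) ≤ asymptoticRank (nurmiev ℂ k) := by
  simp only [Finset.mem_insert, Finset.mem_singleton] at hk
  rcases hk with rfl | rfl | rfl | rfl | rfl
  · exact three_le_asymptoticRank_nurmiev_3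
  · exact three_le_asymptoticRank_nurmiev_5
  · exact three_le_asymptoticRank_nurmiev_six
  · exact three_le_asymptoticRank_nurmiev_7
  · exact three_le_asymptoticRank_nurmiev_11

/-- **THE SHADOW OF THE DOOR, COMPLETE.**  Door D1 (`R̃(T_{cw,2}) ≤ 3`) forces `R̃(N_k) ≤ 3` on all
`21` nilpotent classes below `T_{cw,2}`, and on exactly the five classes of border rank `4` —
`N₃, N₅, N₆, N₇, N₁₁` — this is news: there `R̃(N_k) = 3 < 4 = R̲(N_k)`, five concise format-`3`
instances of Strassen's asymptotic rank conjecture (on the other sixteen `R̃ ≤ R̲ ≤ 3` holds anyway,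
`asymptoticRank_nurmiev_le_three_of_mem`). -/
theorem door_shadow_catalogue (h : asymptoticRank (cwTensor ℂ 2) ≤ 3) :
    (∀ k ∈ ({3, 5, 6, 7, 8, 9, 10, 11, 12, 13, 14, 15, 16, 17, 18, 19, 20, 21, 22, 23, 24} :
        Finset ℕ),
        asymptoticRank (nurmiev ℂ k) ≤ 3) ∧
      ∀ k ∈ ({3, 5, 6, 7, 11} : Finset ℕ),
        asymptoticRank (nurmiev ℂ k) = 3 ∧ algBorderRank (nurmiev ℂ k) = 4 :=
  ⟨fun k hk => (asymptoticRank_nurmiev_le_cwTensor_two k hk).trans h, fun k hk =>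
    ⟨le_antisymm ((asymptoticRank_nurmiev_le_cwTensor_two k (by
        simp only [Finset.mem_insert, Finset.mem_singleton] at hk ⊢; omega)).trans h)
        (three_le_asymptoticRank_nurmiev_of_mem k hk),
      algBorderRank_nurmiev_eq_four_of_mem k hk⟩⟩

end Summit.MatrixMultiplication.MatrixMultiplication.Theorems

end
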